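import Summits.HodgeConjecture.HodgeConjecture.Theorems.HeckePrymWeilHeckePrymAnchorsOfPeriodConstructionCrux
import HarnessLib

/-!
# `HeckePrymAnchors` from a CM-anchored algebraic Weil family (item stmt-HodgeConjecture-14496, route HeckePrymWeil)

Line `Sketch`, continuation lead c37 — the PERIOD-FREE, RIEMANN-FREE residual of the crux
`HeckePrymAnchors`, kernel-checked. The registered stub of the line is the route decl
`DeligneWeilFamily` (item stmt-HodgeConjecture-16866); c34 showed that Deligne's period construction
[U] alone implies the crux (`heckePrymAnchors_of_periodConstruction`), using period surjectivity at ONE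
point of `X⁺(D_X)` — the rational diagonal CM point `J_R` — to obtain a CM projector on `H¹` of that
fibre (`cm_projector_of_periodPoint`) and then Lefschetz `(1,1)` + Kleiman moving
(`cm_weilClassesOf_le_algebraicClasses`).

This file removes the period domain from the hypothesis altogether. The hypothesis [U_alg] of
`kActionAlg_of_cmAnchoredFamily` asks, for every `(X, Φ)` of balanced Weil type `(k, k)`
(`Φ ≫ Φ = -p`, `dim X = 2k`, `dim (V_{i√p} ∩ H^{1,0}) = k`), only for

* an ALGEBRAIC family: `f : 𝒳 → S` smooth projective of relative dimension `2k`, closed in `ℙᴺ × S`,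
  over a smooth irreducible quasi-projective base, with a global endomorphism `g` over `S`, a chart
  `e : X ≅ 𝒳_{s₁}` intertwining `Φ` and `g`, and abelian Weil-type charts `(A'_s, φ'_s)` at every
  complex point (`φ'_s ≫ φ'_s = -p`);
* INTEGRAL LEVEL-`n'` MONODROMY at `s₁` (`n' ≥ 3`): a basis of `H¹(𝒳_{s₁}(ℂ); ℂ)` in which `g_{s₁}^*`
  is an integer matrix and every monodromy `γ_*` is an integer matrix `≡ 1 (mod n')` — what a
  level-`n'` structure on the family gives ([Deligne1982HodgeCycles], proof of Thm. 4.8: the group `Γ`);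
* ONE CM-SPLIT FIBRE: a chart `(Y, Ψ) ≅ 𝒳_{s₀}` and a rational, `Ψ^*`-linear idempotent `Pr` of
  `H¹(Y(ℂ); ℂ)` with `im Pr ∩ V_{i√p} ⊂ H^{0,1}` and `ker Pr ∩ V_{i√p} ⊂ H^{1,0}` (the shape of the
  fibre over `J_R`: `H¹ = P ⊕ N` rational and `K`-stable, `P_{i√p}` anti-holomorphic, `N_{i√p}`
  holomorphic; e.g. any `(Y, Ψ)` `K`-isogenous to `(E^k × E^k, (ι, -ι))`, `E = ℂ/𝒪_K`).

No Weil datum, no period domain, no period surjectivity, no isogeny to a tensor point, no Riemann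
theorem: this is the weakest family statement that either road to item 16866 (Deligne's analytic
`Γ\B → Γ\X⁺` with Baily–Borel/Borel, or Mumford's algebraic `A_{g,δ,n}` with an explicit CM point in
the component of `X`) has to deliver for THIS crux. The proof is c34's `kActionAlg_of_periodConstruction`
with the projector taken as a hypothesis: (i) balancedness of `Y` by transport of the `K`-multiplicity
along a path `s₁ ⤳ s₀` (`finrank_eigenspace_inf_hodgeOneZero_eq_of_path'`), (ii) the KEY LEMMA
`cm_weilClassesOf_le_algebraicClasses`, (iii) the flat section through `e^{-1 *} c` from the integral
level-`n'` monodromy (`exists_continuous_section_of_integral_level`), (iv) assembly into the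
algebraic-anchor form consumed by the landed `heckePrymAnchors_of_kActionAlg` (p139328). No definition,
no `sorry`; the only hypothesis is [U_alg], displayed verbatim.

APPENDED (c37, same lead): the SANDWICH CERTIFICATE `cmAnchoredFamily_of_periodConstruction : [U] → [U_alg]`
— Deligne's period construction [U] (hypothesis `h` of
`deligne1982_weilFamily_levelStructure_of_periodConstruction`, verbatim) delivers [U_alg]: the first
half of c34's `kActionAlg_of_periodConstruction`, cut where the CM projector appears (family through
`X` from [U] at `P = X`; period surjectivity at the ONE rational diagonal point `J_R`;
`cm_projector_of_periodPoint`). So [U] ⟹ [U_alg] ⟹ (algebraic-anchor form) ⟹ `HeckePrymAnchors`, and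
composing the certificate with `heckePrymAnchors_of_cmAnchoredFamily` re-proves the landed
`heckePrymAnchors_of_periodConstruction` (not restated here).
-/

noncomputable section

-- every declaration of this problem lives in `Summit.HodgeConjecture.HodgeConjecture.…` (summit = sub-problem)
set_option linter.dupNamespace false

open CategoryTheory AlgebraicGeometry Limits MonoidalCategory CartesianMonoidalCategory
open Literature.AlgebraicTopology.SingularHomology
open scoped TensorProduct

namespace Summit.HodgeConjecture.HodgeConjecture.Theorems.HeckePrymWeilLine

open Literature.AlgebraicGeometry Literature.AlgebraicGeometry.Motives Literature.AlgebraicGeometry.HodgeTheory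
open Summit.HodgeConjecture.HodgeConjecture.Theses.HeckePrymWeil

/-- **The algebraic-anchor form from a CM-anchored algebraic Weil family** [U_alg]. Suppose that every
complex abelian `2k`-fold `(X, Φ)` with `Φ ≫ Φ = -p` of balanced Weil type `(k, k)` sits, as the fibre
over `s₁` (chart intertwining `Φ` with the global `g`), in a smooth projective family `𝒳 → S` closed
in `ℙᴺ × S` over a smooth irreducible quasi-projective base, with abelian Weil-type charts at every
complex point, integral level-`n' ≥ 3` monodromy at `s₁`, and ONE fibre `𝒳_{s₀} ≅ (Y, Ψ)` carrying a
rational `Ψ^*`-linear idempotent `Pr` of `H¹(Y(ℂ); ℂ)` with `im Pr ∩ V_{i√p} ⊂ H^{0,1}`,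
`ker Pr ∩ V_{i√p} ⊂ H^{1,0}` (a CM-split fibre, as over the rational diagonal point `J_R` of Deligne's
`X⁺`). Then the charts-only family package through every `(X, Φ)` with a non-zero rational Hodge Weil
class holds in ALGEBRAIC-ANCHOR form (the hypothesis of `heckePrymAnchors_of_kActionAlg`): `X` is
balanced by Prop. 4.4 (`finrank_eq_of_mem_weilClassesOf`), so [U_alg] applies; `Y` is balanced by
transport of the `K`-multiplicity along the connected base; the strong Weil plane of `(Y, Ψ)` is
algebraic by the KEY LEMMA `cm_weilClassesOf_le_algebraicClasses` (Lefschetz `(1,1)` on `Y` and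
Kleiman moving); the flat section through `e^{-1 *} c` comes from the integral level-`n'` monodromy
(`exists_continuous_section_of_integral_level`, `det = 1` on `V_±`).
[cite: Deligne1982HodgeCycles, proof of Thm. 4.8 (pp. 47–52), Prop. 4.4, Lemma 4.5]
[cite: vanGeemen1994HodgeAV, 5.3–5.11] -/
theorem kActionAlg_of_cmAnchoredFamily :
    (∀ p : ℕ, p.Prime → p % 4 = 3 → 7 ≤ p → ∀ (k : ℕ), 1 ≤ k → ∀ (X : AbelianVariety ℂ) (Φ : X ⟶ X) (hX : X.dim = 2 * k), Φ ≫ Φ = -((p : ℤ) • 𝟙 X) → Module.finrank ℂ ↥(Module.End.eigenspace (complexBetti.map Φ.hom.hom.hom 1).hom (Complex.I * (Real.sqrt p : ℂ)) ⊓ hodgeOneZero (Motives.isSmoothProjective_of_dim_eq' hX)) = k → ∃ (𝒳 S : SchemeOver ℂ) (f : 𝒳 ⟶ S) (g : 𝒳 ⟶ 𝒳) (s₁ s₀ : ComplexPoints S) (e : X.X ≅ fiberOver f s₁), IsSmoothProjectiveFamily f (2 * k) ∧ (∃ (N : ℕ) (ι : 𝒳 ⟶ projectiveSpace N ℂ ⊗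 S), IsClosedImmersion ι.left ∧ ι ≫ snd (projectiveSpace N ℂ) S = f) ∧ IrreducibleSpace S.left ∧ AlgebraicGeometry.Smooth S.hom ∧ IsQuasiProjectiveOver S ∧ g ≫ f = f ∧ (∀ s : ComplexPoints S, ∃ (A' : AbelianVariety ℂ) (φ' : A' ⟶ A') (e' : A'.X ≅ fiberOver f s), A'.dim = 2 * k ∧ φ' ≫ φ' = -((p : ℤ) • 𝟙 A') ∧ (e'.hom ≫ fiberι f s) ≫ g = φ'.hom.hom.hom ≫ (e'.hom ≫ fiberι f s)) ∧ (e.hom ≫ fiberι f s₁) ≫ g = Φ.hom.hom.hom ≫ (e.hom ≫ fiberι f s₁) ∧ (∃ (ιb : Type) (_ : Fintype ιb) (_ : DecidableEq ιb) (b : Module.Basis ιb ℂ (complexBetti (fiberOver f s₁) 1)) (Jℤ : Matrix ιb ιb ℤ) (n' : ℕ), 3 ≤ n' ∧ (∀ g₁ : fiberOver f s₁ ⟶ fiberOver f s₁, g₁ ≫ fiberι f s₁ = fiberι f s₁ ≫ g → LinearMap.toMatrix b b (complexBetti.map g₁ 1).hom = Jℤ.map (Int.castRingHom ℂ)) ∧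 ∀ (hU : IsCohomologicallyLocallyTrivialOn f (Set.univ : Set (ComplexPoints S))) (γ : Path.Homotopic.Quotient (⟨s₁, Set.mem_univ s₁⟩ : (Set.univ : Set (ComplexPoints S))) ⟨s₁, Set.mem_univ s₁⟩), ∃ Dℤ : Matrix ιb ιb ℤ, LinearMap.toMatrix b b (transportLinear f 1 hU γ :) = (1 + (n' : ℤ) • Dℤ).map (Int.castRingHom ℂ)) ∧ ∃ (Y : AbelianVariety ℂ) (Ψ : Y ⟶ Y) (e₀ : Y.X ≅ fiberOver f s₀) (hY : Y.dim = 2 * k), Ψ ≫ Ψ = -((p : ℤ) • 𝟙 Y) ∧ (e₀.hom ≫ fiberι f s₀) ≫ g = Ψ.hom.hom.hom ≫ (e₀.hom ≫ fiberι f s₀) ∧ ∃ Pr : complexBetti Y.X 1 →ₗ[ℂ] complexBetti Y.X 1, IsIdempotentElem Pr ∧ Pr ∘ₗ (complexBetti.map Ψ.hom.hom.hom 1).hom = (complexBetti.map Ψ.hom.hom.hom 1).hom ∘ₗ Pr ∧ (∀ x, IsRationalClass x → IsRationalClass (Pr x)) ∧ LinearMap.range Pr ⊓ Module.End.eigenspace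 (complexBetti.map Ψ.hom.hom.hom 1).hom (Complex.I * (Real.sqrt p : ℂ)) ≤ hodgeZeroOne (Motives.isSmoothProjective_of_dim_eq' hY) ∧ LinearMap.ker Pr ⊓ Module.End.eigenspace (complexBetti.map Ψ.hom.hom.hom 1).hom (Complex.I * (Real.sqrt p : ℂ)) ≤ hodgeOneZero (Motives.isSmoothProjective_of_dim_eq' hY)) → ∀ p : ℕ, p.Prime → p % 4 = 3 → 7 ≤ p → ∀ (k : ℕ), 1 ≤ k → ∀ (X : AbelianVariety ℂ) (Φ : X ⟶ X), X.dim = 2 * k → Φ ≫ Φ = -((p : ℤ) • 𝟙 X) → ∀ c : complexBetti X.X (2 * k), c ∈ weilClassesOf X Φ k p → c ≠ 0 → IsRationalClass c → IsOfHodgeType (2 * k) X.X (2 * k) k k c → ∃ (𝒳 S : SchemeOver ℂ) (f : 𝒳 ⟶ S) (g : 𝒳 ⟶ 𝒳) (s₁ s₀ : ComplexPoints S) (e : X.X ≅ fiberOver f s₁) (σ : ComplexPoints S → FiberClass f (2 * k)), IsSmoothProjectiveFamily f (2 * k) ∧ (∃ (N : ℕ) (ι : 𝒳 ⟶ projectiveSpace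 N ℂ ⊗ S), IsClosedImmersion ι.left ∧ ι ≫ snd (projectiveSpace N ℂ) S = f) ∧ IrreducibleSpace S.left ∧ AlgebraicGeometry.Smooth S.hom ∧ IsQuasiProjectiveOver S ∧ g ≫ f = f ∧ (∀ s : ComplexPoints S, ∃ (A' : AbelianVariety ℂ) (φ' : A' ⟶ A') (e' : A'.X ≅ fiberOver f s), A'.dim = 2 * k ∧ φ' ≫ φ' = -((p : ℤ) • 𝟙 A') ∧ (e'.hom ≫ fiberι f s) ≫ g = φ'.hom.hom.hom ≫ (e'.hom ≫ fiberι f s)) ∧ (e.hom ≫ fiberι f s₁) ≫ g = Φ.hom.hom.hom ≫ (e.hom ≫ fiberι f s₁) ∧ Continuous σ ∧ (∀ s, (σ s).pt = s) ∧ σ s₁ = ⟨s₁, complexBetti.map e.inv (2 * k) c⟩ ∧ ∃ (Y : AbelianVariety ℂ) (Ψ : Y ⟶ Y) (e₀ : Y.X ≅ fiberOver f s₀), weilClassesOf Y Ψ k p ≤ algebraicClasses Y.X k ∧ (e₀.hom ≫ fiberι f s₀) ≫ g = Ψ.hom.hom.hom ≫ (e₀.hom ≫ fiberι f s₀) :=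 by
  intro h p hp hp4 hp7 k hk X Φ hX hΦ c hc hc0 hrat hH
  have hp0 : 0 < p := hp.pos
  have hΦ'' : Φ ≫ Φ = -(p • 𝟙 X) := by rw [hΦ, natCast_zsmul]
  set μ : ℂ := Complex.I * (Real.sqrt p : ℂ) with hμ
  -- `X` is balanced (Prop. 4.4 applied to the non-zero Hodge Weil class `c`)
  have hbalX : Module.finrank ℂ ↥(Module.End.eigenspace (complexBetti.map Φ.hom.hom.hom 1).hom μ ⊓
      hodgeOneZero (Motives.isSmoothProjective_of_dim_eq' hX)) = k :=
    finrank_eq_of_mem_weilClassesOf hk hX hp0 hΦ'' hc hc0 hH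
  -- the CM-anchored family through `X`
  obtain ⟨𝒳, S, f, g, s₁, s₀, e, hfam, hemb, hirr, hsm, hSqp, hg, hfib, he, hlev, Y, Ψ, e₀, hY, hΨ, he₀,
    Pr, hPr, hPrT, hPrrat, hrange, hker⟩ := h p hp hp4 hp7 k hk X Φ hX hΦ hbalX
  have hΨ' : Ψ ≫ Ψ = -(p • 𝟙 Y) := by rw [hΨ, natCast_zsmul]
  -- the base: `S(ℂ)` is a (locally) path-connected manifold and `R• f_* ℂ` is a local system on it
  haveI := hsm
  haveI := hirr
  haveI : LocallyOfFiniteType S.hom := hSqp.locallyOfFiniteType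
  haveI : ConnectedSpace (ComplexPoints S) := (Motives.ComplexPoints.connectedSpace_iff_holds S).2 inferInstance
  obtain ⟨dS, hdS⟩ := exists_smoothOfRelativeDimension_of_connectedSpace_complexPoints S
  haveI := hdS
  haveI := pathConnectedSpace_complexPoints_of_smoothOfRelativeDimension S dS
  letI := Motives.ComplexPoints.chartedSpace S dS
  haveI : LocallyPathConnectedSpace (ComplexPoints S) :=
    ChartedSpace.locallyPathConnectedSpace (EuclideanSpace ℝ (Fin (2 * dS))) (ComplexPoints S)
  have hUct := isCohomologicallyLocallyTrivialOn_univ_of_isSmoothProjectiveFamily f dS hfam hSqp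
  have hgf' := fun t ↦ exists_fiberHom_comp_fiberι f g hg t
  choose gf hgf using hgf'
  have hsp : ∀ t : ComplexPoints S, IsSmoothProjective (2 * k) (fiberOver f t) := fun t ↦ hfam.isSmoothProjective t
  obtain ⟨mε, εm, hεm⟩ := exists_forall_isClosedImmersion_fiberι_comp f hfam hemb hSqp
  -- the chart at `s₁`
  haveI := finite_complexBetti (hfam.isSmoothProjective s₁) 1
  have he' : e.hom ≫ gf s₁ = Φ.hom.hom.hom ≫ e.hom :=
    hom_comp_fiberHom_eq_of_comp_fiberι f g (hgf s₁) e Φ.hom.hom.hom he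
  have hE₁ : Module.finrank ℂ ↥(Module.End.eigenspace (complexBetti.map (gf s₁) 1).hom μ) = 2 * k := by
    rw [finrank_eigenspace_eq_of_iso e (gf s₁) he' μ 1]
    have h2 := two_mul_finrank_eigenspace_eq hp0 hΦ''
    rw [Motives.AbelianVariety.finrank_complexBetti_one, hX, ← hμ] at h2
    omega
  /- (i) `Y` is balanced: `X` is, and the multiplicity is constant along the connected base. -/
  have hbalY : Module.finrank ℂ ↥(Module.End.eigenspace (complexBetti.map Ψ.hom.hom.hom 1).hom μ ⊓
      hodgeOneZero (Motives.isSmoothProjective_of_dim_eq' hY)) = k := by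
    have hbal₁ : Module.finrank ℂ ↥(Module.End.eigenspace (complexBetti.map (gf s₁) 1).hom μ ⊓
        hodgeOneZero (hsp s₁)) = k := by
      rw [finrank_eigenspace_inf_hodgeOneZero_eq_of_iso hX (hsp s₁) e (gf s₁) he' μ]
      exact hbalX
    have he₀' : e₀.hom ≫ gf s₀ = Ψ.hom.hom.hom ≫ e₀.hom :=
      hom_comp_fiberHom_eq_of_comp_fiberι f g (hgf s₀) e₀ Ψ.hom.hom.hom he₀
    let γ : Path (⟨s₁, Set.mem_univ s₁⟩ : (Set.univ : Set (ComplexPoints S))) ⟨s₀, Set.mem_univ s₀⟩ :=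
      (PathConnectedSpace.somePath s₁ s₀).map (continuous_id.subtype_mk _)
    rw [← finrank_eigenspace_inf_hodgeOneZero_eq_of_iso hY (hsp s₀) e₀ (gf s₀) he₀' μ]
    exact finrank_eigenspace_inf_hodgeOneZero_eq_of_path' f (by omega) hsp hUct g hg gf hgf μ εm hεm ⟦γ⟧
      hE₁ hbal₁
  /- (ii) the KEY LEMMA at the CM-split fibre: the strong Weil plane of `(Y, Ψ)` is algebraic. -/
  have hWalg : weilClassesOf Y Ψ k p ≤ algebraicClasses Y.X k :=
    cm_weilClassesOf_le_algebraicClasses hp0 hk hY hΨ' Pr hPr hPrT hPrrat hrange hker hbalY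
  /- (iii) the flat section through `e^{-1 *} c` from the integral level-`n'` monodromy. -/
  obtain ⟨ιb, _, _, b, Jℤ, n', hn', hJb, hlevel⟩ := hlev
  have hJ := hJb (gf s₁) (hgf s₁)
  have hGG : (complexBetti.map (gf s₁) 1).hom * (complexBetti.map (gf s₁) 1).hom = -((p : ℂ) • 1) := by
    have hinjE : Function.Injective (complexBetti.map e.hom 1) := by
      intro v w hvw
      have h1 := congrArg (complexBetti.map e.inv 1) hvw
      rwa [complexBetti_map_inv_map_hom_of_chart, complexBetti_map_inv_map_hom_of_chart] at h1
    have hcommE : ∀ w, complexBetti.map e.hom 1 (complexBetti.map (gf s₁) 1 w) =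
        complexBetti.map Φ.hom.hom.hom 1 (complexBetti.map e.hom 1 w) := by
      intro w
      rw [← ModuleCat.comp_apply, ← complexBetti.map_comp, he', complexBetti.map_comp, ModuleCat.comp_apply]
    ext v
    apply hinjE
    change complexBetti.map e.hom 1 (complexBetti.map (gf s₁) 1 (complexBetti.map (gf s₁) 1 v)) =
      complexBetti.map e.hom 1 ((-((p : ℂ) • (1 : Module.End ℂ _))) v)
    rw [hcommE, hcommE, complexBetti_map_map_one_of_comp_self hΦ'', LinearMap.neg_apply,
      LinearMap.smul_apply, Module.End.one_apply, map_neg, map_smul]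
  have hJ2 : Jℤ * Jℤ = -((p : ℤ) • 1) := by
    apply Matrix.map_injective (RingHom.injective_int (Int.castRingHom ℂ))
    change (Jℤ * Jℤ).map _ = (-((p : ℤ) • (1 : Matrix ιb ιb ℤ))).map _
    rw [Matrix.map_mul, ← hJ, ← LinearMap.toMatrix_mul, hGG, map_neg, LinearEquiv.map_smul,
      LinearMap.toMatrix_one]
    ext i j
    simp only [Matrix.map_apply, Matrix.neg_apply, Matrix.smul_apply, Matrix.one_apply, smul_eq_mul,
      mul_ite, mul_one, mul_zero, eq_intCast, Int.cast_neg, Int.cast_ite, Int.cast_natCast, Int.cast_zero]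
  have hEm : Module.finrank ℂ ↥(Module.End.eigenspace (complexBetti.map (gf s₁) 1).hom (-μ)) = 2 * k := by
    rw [finrank_eigenspace_eq_of_iso e (gf s₁) he' _ 1, hμ, ← finrank_eigenspace_eq_finrank_eigenspace_neg hp0 hΦ'',
      ← finrank_eigenspace_eq_of_iso e (gf s₁) he' _ 1]
    exact hE₁
  let bμ := Module.finBasisOfFinrankEq ℂ _ hE₁
  let bν := Module.finBasisOfFinrankEq ℂ _ hEm
  have hα := map_inv_mem_eigenLines_of_mem_weilClassesOf e (gf s₁) hp0 hX hΦ'' he' hc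
  obtain ⟨σ, hσ, hpt, hσ₁⟩ := exists_continuous_section_of_integral_level f hUct g hg gf hgf s₁ b hp0 Jℤ
    hJ hJ2 hn' (hlevel hUct) μ (I_mul_sqrt_sq p) bμ bν hα
  /- (iv) assemble the algebraic-anchor package. -/
  exact ⟨𝒳, S, f, g, s₁, s₀, e, σ, hfam, hemb, hirr, hsm, hSqp, hg, hfib, he, hσ, hpt, hσ₁,
    Y, Ψ, e₀, hWalg, he₀⟩

/-- **`HeckePrymAnchors` from a CM-anchored algebraic Weil family** — the period-free, Riemann-free
residual of the crux of line `Sketch`: [U_alg] (for every balanced `(X, Φ)`: an algebraic smooth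
projective Weil-type family through `X` over a smooth irreducible quasi-projective base, closed in
`ℙᴺ × S`, with a global `√-p` and abelian charts, integral level-`n' ≥ 3` monodromy at the base point,
and ONE fibre with a rational CM projector on `H¹`) implies the crux, by
`kActionAlg_of_cmAnchoredFamily` and the landed `heckePrymAnchors_of_kActionAlg` (p139328). Both
Deligne's period construction [U] (c34: the fibre over the rational diagonal point `J_R` carries the
projector, `cm_projector_of_periodPoint`) and the route item `DeligneWeilFamily` (item
stmt-HodgeConjecture-16866) are renderings of a construction that delivers [U_alg]; what [U_alg]
isolates is the purely algebro-geometric content any constructor owes this crux: a deformation of the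
abstract `(X, Φ)` over a smooth irreducible base with level structure, reaching one CM-split fibre.
[cite: Deligne1982HodgeCycles, proof of Thm. 4.8 (pp. 47–52) with Prop. 4.4 and Lemma 4.5]
[cite: vanGeemen1994HodgeAV, 5.3–5.11] [cite: MumfordFogartyKirwan1994, Thm. 7.9–7.10] -/
theorem heckePrymAnchors_of_cmAnchoredFamily :
    (∀ p : ℕ, p.Prime → p % 4 = 3 → 7 ≤ p → ∀ (k : ℕ), 1 ≤ k → ∀ (X : AbelianVariety ℂ) (Φ : X ⟶ X) (hX : X.dim = 2 * k), Φ ≫ Φ = -((p : ℤ) • 𝟙 X) → Module.finrank ℂ ↥(Module.End.eigenspace (complexBetti.map Φ.hom.hom.hom 1).hom (Complex.I * (Real.sqrt p : ℂ)) ⊓ hodgeOneZero (Motives.isSmoothProjective_of_dim_eq' hX)) = k → ∃ (𝒳 S : SchemeOver ℂ) (f : 𝒳 ⟶ S) (g : 𝒳 ⟶ 𝒳) (s₁ s₀ : ComplexPoints S) (e : X.X ≅ fiberOver f s₁), IsSmoothProjectiveFamily f (2 * k) ∧ (∃ (N : ℕ) (ι : 𝒳 ⟶ projectiveSpace N ℂ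 ⊗ S), IsClosedImmersion ι.left ∧ ι ≫ snd (projectiveSpace N ℂ) S = f) ∧ IrreducibleSpace S.left ∧ AlgebraicGeometry.Smooth S.hom ∧ IsQuasiProjectiveOver S ∧ g ≫ f = f ∧ (∀ s : ComplexPoints S, ∃ (A' : AbelianVariety ℂ) (φ' : A' ⟶ A') (e' : A'.X ≅ fiberOver f s), A'.dim = 2 * k ∧ φ' ≫ φ' = -((p : ℤ) • 𝟙 A') ∧ (e'.hom ≫ fiberι f s) ≫ g = φ'.hom.hom.hom ≫ (e'.hom ≫ fiberι f s)) ∧ (e.hom ≫ fiberι f s₁) ≫ g = Φ.hom.hom.hom ≫ (e.hom ≫ fiberι f s₁) ∧ (∃ (ιb : Type) (_ : Fintype ιb) (_ : DecidableEq ιb) (b : Module.Basis ιb ℂ (complexBetti (fiberOver f s₁) 1)) (Jℤ : Matrix ιb ιb ℤ) (n' : ℕ), 3 ≤ n' ∧ (∀ g₁ : fiberOver f s₁ ⟶ fiberOver f s₁, g₁ ≫ fiberι f s₁ = fiberι f s₁ ≫ g → LinearMap.toMatrix b b (complexBetti.map g₁ 1).hom = Jℤ.map (Int.castRingHom ℂ))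 ∧ ∀ (hU : IsCohomologicallyLocallyTrivialOn f (Set.univ : Set (ComplexPoints S))) (γ : Path.Homotopic.Quotient (⟨s₁, Set.mem_univ s₁⟩ : (Set.univ : Set (ComplexPoints S))) ⟨s₁, Set.mem_univ s₁⟩), ∃ Dℤ : Matrix ιb ιb ℤ, LinearMap.toMatrix b b (transportLinear f 1 hU γ :) = (1 + (n' : ℤ) • Dℤ).map (Int.castRingHom ℂ)) ∧ ∃ (Y : AbelianVariety ℂ) (Ψ : Y ⟶ Y) (e₀ : Y.X ≅ fiberOver f s₀) (hY : Y.dim = 2 * k), Ψ ≫ Ψ = -((p : ℤ) • 𝟙 Y) ∧ (e₀.hom ≫ fiberι f s₀) ≫ g = Ψ.hom.hom.hom ≫ (e₀.hom ≫ fiberι f s₀) ∧ ∃ Pr : complexBetti Y.X 1 →ₗ[ℂ] complexBetti Y.X 1, IsIdempotentElem Pr ∧ Pr ∘ₗ (complexBetti.map Ψ.hom.hom.hom 1).hom = (complexBetti.map Ψ.hom.hom.hom 1).hom ∘ₗ Pr ∧ (∀ x, IsRationalClass x → IsRationalClass (Pr x)) ∧ LinearMap.range Pr ⊓ Module.End.eigenspace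 (complexBetti.map Ψ.hom.hom.hom 1).hom (Complex.I * (Real.sqrt p : ℂ)) ≤ hodgeZeroOne (Motives.isSmoothProjective_of_dim_eq' hY) ∧ LinearMap.ker Pr ⊓ Module.End.eigenspace (complexBetti.map Ψ.hom.hom.hom 1).hom (Complex.I * (Real.sqrt p : ℂ)) ≤ hodgeOneZero (Motives.isSmoothProjective_of_dim_eq' hY)) → Summit.HodgeConjecture.HodgeConjecture.Theses.HeckePrymWeil.HeckePrymAnchors :=
  fun h => heckePrymAnchors_of_kActionAlg (kActionAlg_of_cmAnchoredFamily h)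

/-- **Deligne's period construction delivers a CM-anchored algebraic Weil family**: [U] ⟹ [U_alg]
(sandwich certificate for the hypothesis of `heckePrymAnchors_of_cmAnchoredFamily`). Given [U] (for
every `(P, ψ₀)`: the smooth projective family over a smooth irreducible quasi-projective base embedded
in `ℙᴺ × S`, the global `√-d` with fibre charts, the level-`n'` structure at the base point and period
surjectivity onto `X⁺(D_P)`; [Deligne1982HodgeCycles], proof of Thm. 4.8, pp. 48–51), every `(X, Φ)`
with `Φ ≫ Φ = -p`, `dim X = 2k` (balanced or not — the balancedness hypothesis of [U_alg] is not
used) sits in such a family whose fibre over the rational diagonal CM point `J_R` of `X⁺(D_X)`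
(`WeilDatum.exists_isWeilComplexStructure_rational`) carries a rational `Ψ^*`-linear idempotent `Pr`
of `H¹` with `im Pr ∩ V_{i√p} ⊂ H^{0,1}` and `ker Pr ∩ V_{i√p} ⊂ H^{1,0}` (`cm_projector_of_periodPoint`,
read through the `K`-linear `β : H¹(X; ℚ) ≃ H¹(Y_{s₀}; ℚ)` of period surjectivity at `J_R`). Hence
`heckePrymAnchors_of_cmAnchoredFamily ∘ cmAnchoredFamily_of_periodConstruction` is another proof of
the landed `heckePrymAnchors_of_periodConstruction`: nothing this crux needs from Deligne's
construction is lost in [U_alg].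
[cite: Deligne1982HodgeCycles, proof of Thm. 4.8 (pp. 47–52)] [cite: vanGeemen1994HodgeAV, 5.3–5.11] -/
theorem cmAnchoredFamily_of_periodConstruction :
    (∀ (n d : ℕ), 1 ≤ n → 1 ≤ d → ∀ (P : AbelianVariety ℂ) (ψ₀ : P ⟶ P) (e : ProjectiveEmbedding P.X) (a : complexBetti (projectiveSpace e.n ℂ) 2), P.dim = 2 * n → ψ₀ ≫ ψ₀ = -((d : ℤ) • 𝟙 P) → ∀ (ha : IsRationalClass a) (ha0 : a ≠ 0), ∃ (𝒳 S : SchemeOver ℂ) (f : 𝒳 ⟶ S) (g : 𝒳 ⟶ 𝒳) (s₀ : ComplexPoints S) (e' : P.X ≅ fiberOver f s₀) (Y : ComplexPoints S → AbelianVariety ℂ) (Ψ : ∀ s, Y s ⟶ Y s) (ε : ∀ s, (Y s).X ≅ fiberOver f s) (N : ℕ) (ι : 𝒳 ⟶ CategoryTheory.MonoidalCategoryStruct.tensorObj (projectiveSpace N ℂ) S), IsSmoothProjectiveFamily f (2 * n) ∧ AlgebraicGeometry.IsClosedImmersion ι.left ∧ ι ≫ CategoryTheory.CartesianMonoidalCategory.snd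 (projectiveSpace N ℂ) S = f ∧ IrreducibleSpace S.left ∧ AlgebraicGeometry.Smooth S.hom ∧ IsQuasiProjectiveOver S ∧ g ≫ f = f ∧ (e'.hom ≫ fiberι f s₀) ≫ g = ψ₀.hom.hom.hom ≫ (e'.hom ≫ fiberι f s₀) ∧ (∀ s, (Y s).dim = 2 * n ∧ Ψ s ≫ Ψ s = -((d : ℤ) • 𝟙 (Y s)) ∧ ((ε s).hom ≫ fiberι f s) ≫ g = (Ψ s).hom.hom.hom ≫ ((ε s).hom ≫ fiberι f s)) ∧ (∃ (ιb : Type) (_ : Fintype ιb) (_ : DecidableEq ιb) (b : Module.Basis ιb ℂ (complexBetti (fiberOver f s₀) 1)) (Jℤ : Matrix ιb ιb ℤ) (n' : ℕ), 3 ≤ n' ∧ (∀ g₀ : fiberOver f s₀ ⟶ fiberOver f s₀, g₀ ≫ fiberι f s₀ = fiberι f s₀ ≫ g → LinearMap.toMatrix b b (complexBetti.map g₀ 1).hom = Jℤ.map (Int.castRingHom ℂ)) ∧ ∀ (hU : IsCohomologicallyLocallyTrivialOn f (Set.univ : Set (ComplexPoints S))) (γ : Path.Homotopic.Quotient (⟨s₀,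 Set.mem_univ s₀⟩ : (Set.univ : Set (ComplexPoints S))) ⟨s₀, Set.mem_univ s₀⟩), ∃ Dℤ : Matrix ιb ιb ℤ, LinearMap.toMatrix b b (transportLinear f 1 hU γ :) = (1 + (n' : ℤ) • Dℤ).map (Int.castRingHom ℂ)) ∧ ∃ (m : ℕ) (hm : 1 ≤ m) (hPm : P.dim = m + 1) (hd : 0 < d) (hψ : ψ₀ ≫ ψ₀ = -(d • 𝟙 P)) (ω : complexBetti P.X (2 + 2 * m)) (hω : IsRationalClass ω) (hω0 : ω ≠ 0), ∀ (J : (weilDatumOfKsymm hm hPm hd hψ e ha ha0 hω hω0).Cx →ₗ[ℂ] (weilDatumOfKsymm hm hPm hd hψ e ha ha0 hω hω0).Cx) (hW : Motives.IsWeilComplexStructure (weilDatumOfKsymm hm hPm hd hψ e ha ha0 hω hω0).hForm J), ∃ (s : ComplexPoints S) (β : bettiCohomology P.X 1 ≃ₗ[ℚ] bettiCohomology (Y s).X 1), (∀ x, β (bettiCohomology.map ψ₀.hom.hom.hom 1 x) = bettiCohomology.map (Ψ s).hom.hom.hom 1 (β x)) ∧ ∀ x ∈ ((weilDatumOfKsymm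 hm hPm hd hψ e ha ha0 hω hω0).hodgeStructure J hW.sq).piece 1 0, IsOfHodgeType (2 * n) (Y s).X 1 1 0 (Motives.ofRatClassBaseChange (ComplexPoints (Y s).X) 1 (β.toLinearMap.baseChange ℂ x))) → (∀ p : ℕ, p.Prime → p % 4 = 3 → 7 ≤ p → ∀ (k : ℕ), 1 ≤ k → ∀ (X : AbelianVariety ℂ) (Φ : X ⟶ X) (hX : X.dim = 2 * k), Φ ≫ Φ = -((p : ℤ) • 𝟙 X) → Module.finrank ℂ ↥(Module.End.eigenspace (complexBetti.map Φ.hom.hom.hom 1).hom (Complex.I * (Real.sqrt p : ℂ)) ⊓ hodgeOneZero (Motives.isSmoothProjective_of_dim_eq' hX)) = k → ∃ (𝒳 S : SchemeOver ℂ) (f : 𝒳 ⟶ S) (g : 𝒳 ⟶ 𝒳) (s₁ s₀ : ComplexPoints S) (e : X.X ≅ fiberOver f s₁), IsSmoothProjectiveFamily f (2 * k) ∧ (∃ (N : ℕ) (ι : 𝒳 ⟶ projectiveSpace N ℂ ⊗ S), IsClosedImmersion ι.left ∧ ι ≫ snd (projectiveSpace N ℂ) S = f) ∧ IrreducibleSpace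 S.left ∧ AlgebraicGeometry.Smooth S.hom ∧ IsQuasiProjectiveOver S ∧ g ≫ f = f ∧ (∀ s : ComplexPoints S, ∃ (A' : AbelianVariety ℂ) (φ' : A' ⟶ A') (e' : A'.X ≅ fiberOver f s), A'.dim = 2 * k ∧ φ' ≫ φ' = -((p : ℤ) • 𝟙 A') ∧ (e'.hom ≫ fiberι f s) ≫ g = φ'.hom.hom.hom ≫ (e'.hom ≫ fiberι f s)) ∧ (e.hom ≫ fiberι f s₁) ≫ g = Φ.hom.hom.hom ≫ (e.hom ≫ fiberι f s₁) ∧ (∃ (ιb : Type) (_ : Fintype ιb) (_ : DecidableEq ιb) (b : Module.Basis ιb ℂ (complexBetti (fiberOver f s₁) 1)) (Jℤ : Matrix ιb ιb ℤ) (n' : ℕ), 3 ≤ n' ∧ (∀ g₁ : fiberOver f s₁ ⟶ fiberOver f s₁, g₁ ≫ fiberι f s₁ = fiberι f s₁ ≫ g → LinearMap.toMatrix b b (complexBetti.map g₁ 1).hom = Jℤ.map (Int.castRingHom ℂ)) ∧ ∀ (hU : IsCohomologicallyLocallyTrivialOn f (Set.univ : Set (ComplexPoints S))) (γ : Path.Homotopic.Quotient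 (⟨s₁, Set.mem_univ s₁⟩ : (Set.univ : Set (ComplexPoints S))) ⟨s₁, Set.mem_univ s₁⟩), ∃ Dℤ : Matrix ιb ιb ℤ, LinearMap.toMatrix b b (transportLinear f 1 hU γ :) = (1 + (n' : ℤ) • Dℤ).map (Int.castRingHom ℂ)) ∧ ∃ (Y : AbelianVariety ℂ) (Ψ : Y ⟶ Y) (e₀ : Y.X ≅ fiberOver f s₀) (hY : Y.dim = 2 * k), Ψ ≫ Ψ = -((p : ℤ) • 𝟙 Y) ∧ (e₀.hom ≫ fiberι f s₀) ≫ g = Ψ.hom.hom.hom ≫ (e₀.hom ≫ fiberι f s₀) ∧ ∃ Pr : complexBetti Y.X 1 →ₗ[ℂ] complexBetti Y.X 1, IsIdempotentElem Pr ∧ Pr ∘ₗ (complexBetti.map Ψ.hom.hom.hom 1).hom = (complexBetti.map Ψ.hom.hom.hom 1).hom ∘ₗ Pr ∧ (∀ x, IsRationalClass x → IsRationalClass (Pr x)) ∧ LinearMap.range Pr ⊓ Module.End.eigenspace (complexBetti.map Ψ.hom.hom.hom 1).hom (Complex.I * (Real.sqrt p : ℂ)) ≤ hodgeZeroOne (Motives.isSmoothProjective_of_dim_eq'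 hY) ∧ LinearMap.ker Pr ⊓ Module.End.eigenspace (complexBetti.map Ψ.hom.hom.hom 1).hom (Complex.I * (Real.sqrt p : ℂ)) ≤ hodgeOneZero (Motives.isSmoothProjective_of_dim_eq' hY)) := by
  intro h p hp hp4 hp7 k hk X Φ hX hΦ _hbal
  have hp0 : 0 < p := hp.pos
  -- a projective embedding of `X` and a non-zero rational class on its projective space
  have hXsp : IsSmoothProjective (2 * k) X.X := Motives.isSmoothProjective_of_dim_eq' hX
  let eX : ProjectiveEmbedding X.X := hXsp.isProjectiveOver.projectiveEmbedding
  have hNX : 1 ≤ eX.n := le_trans (by omega) (le_of_isClosedImmersion_projectiveSpace hXsp eX.ι)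
  obtain ⟨a, ha, ha0⟩ := exists_isRationalClass_ne_zero_projectiveSpace hNX
  -- the period construction through `X`
  obtain ⟨𝒳, S, f, g, s₁, e, Yf, Ψf, ε, N, ι, hfam, hιci, hιf, hirr, hsm, hSqp, hg, he, hfib, hlev, hU⟩ :=
    h k p hk hp0 X Φ eX a hX hΦ ha ha0
  obtain ⟨m, hm, hXm, hd, hΦ', ω, hω, hω0, hsurj⟩ := hU
  set D := weilDatumOfKsymm hm hXm hd hΦ' eX ha ha0 hω hω0 with hD
  haveI : FiniteDimensional ℚ (bettiCohomology X.X 1) := finite_bettiCohomology_one X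
  have hV : Module.finrank ℚ (bettiCohomology X.X 1) = 4 * k := by rw [finrank_bettiCohomology_one, hX]; ring
  -- the rational point `J_R` of `X⁺(D)` and the fibre `Y = Y_{s₀}` over it
  obtain ⟨P, Nn, R, hRα, hPα, hNα, hcpl, -, -, -, -, -, -, -, -, hW, hEP, hEN, -, -⟩ :=
    D.exists_isWeilComplexStructure_rational
  obtain ⟨s₀, β, hβK, hβH⟩ := hsurj _ hW
  obtain ⟨hY₀, hΨ₀, hε₀⟩ := hfib s₀
  have hβH' : ∀ x ∈ HodgeStructure.cxF1 (D.realJ ((D.c : ℂ) • D.cxMap R hRα)),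
      IsOfHodgeType (2 * k) (Yf s₀).X 1 1 0
        (Motives.ofRatClassBaseChange (ComplexPoints (Yf s₀).X) 1 (β.toLinearMap.baseChange ℂ x)) :=
    fun x hx => hβH x (by rwa [WeilDatum.piece_one_zero_hodgeStructure])
  have hβK' : ∀ x, β (D.α x) = bettiCohomology.map (Ψf s₀).hom.hom.hom 1 (β x) := fun x => hβK x
  -- the CM projector at `Y_{s₀}`
  set μ : ℂ := Complex.I * (Real.sqrt p : ℂ) with hμ
  have hι : D.iSqrt = μ := by
    rw [hμ, WeilDatum.iSqrt, hD, weilDatumOfKsymm_d, Rat.cast_natCast]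
  obtain ⟨Pr, hPr, hPrT, hPrrat, hrange, hker⟩ :=
    cm_projector_of_periodPoint hY₀ hV D hRα hPα hNα hcpl hW.sq hEP hEN β (Ψf s₀) hβK' hβH'
  rw [hι] at hrange hker
  -- assemble [U_alg]
  exact ⟨𝒳, S, f, g, s₁, s₀, e, hfam, ⟨N, ι, hιci, hιf⟩, hirr, hsm, hSqp, hg,
    fun t => ⟨Yf t, Ψf t, ε t, (hfib t).1, (hfib t).2.1, (hfib t).2.2⟩, he, hlev,
    Yf s₀, Ψf s₀, ε s₀, hY₀, hΨ₀, hε₀, Pr, hPr, hPrT, hPrrat, hrange, hker⟩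

end Summit.HodgeConjecture.HodgeConjecture.Theorems.HeckePrymWeilLine

end
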